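import Summits.BirchSwinnertonDyer.BirchSwinnertonDyer.Theorems.AlignedTransportAtTwoBSDOfMainConjectureRankOneAtTwoEulerCharAtTwoKerGCasselsPositiveRank
import Summits.BirchSwinnertonDyer.BirchSwinnertonDyer.Theorems.PublishedInputsGreenbergKerGCountOfCassels
import HarnessLib

/-!
# Route `AlignedTransportAtTwo`, crux C3′ `BSDOfMainConjectureRankOneAtTwo` (stmt-BirchSwinnertonDyer-23008), line `birth`,
# the (L) road of the kernel index: the IMAGE of Greenberg's `ker g₀ = A₀/Sel₀ ↪ ∏_{v∈S} 𝒦_{v,0}[p^∞]` in POSITIVE rank —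
# a family of local classes is a value of the embedding as soon as its point obstruction vanishes; and the obstruction of a
# family coming from a global class vanishes (reciprocity)

HONEST FRAMING (cell `bsd-f1-sign2`, attach seat `bsd-line-att-p3` g11 under the C3′ lead lineage `bsd-line-att-p1`;
`--supports stmt-BirchSwinnertonDyer-23008 --as helper`). BSD is NOT proved; C3′ is NOT closed; nothing is asserted. THEOREMS
ONLY (no `def`, no named fact, no `sorry`). Step (b) of `Cruxes/BSDOfMainConjectureRankOneAtTwo/KERINDEX-L-ROAD-att-p3-g10.md` §3,
on top of the positive-rank Cassels theorem of the sibling file `…EulerCharAtTwoKerGCassels` and of att-p3 g10's embedding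
`…EulerCharAtTwoKerGEmbedding.exists_kerG_zero_embedding` (whose value on `[y]` is `(loc_v y)_{v∈S}`).

* §1 `exists_mem_selmerInftyPreimage_of_pointObstruction` — **IMAGE ⊇ POINT-ORTHOGONAL CLASSES** (every number field `K : Type`,
  every `p`, the CYCLOTOMIC `ℤ_p`-extension `κ`, any rank): `E(K̄)[p^∞]^{Γ_K} = 0`, `S ⊇ {v ∣ p} ∪ {bad}` finite, local classes
  `x_v ∈ 𝒦_{v,0}[p^∞]` (`v ∈ S`) killed by `p^n`, a level `p^k` (`k = n + 1 + e`) with a Poitou–Tate family and a Weil pairing, Kummer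
  lifts `t_v ∈ H¹(K_v, E[p^k])` of the `x_v` on `S` and of `0` at the infinite places, the Ш-exponent hypothesis
  (`p^e • c ∈ κ_{p^k}(E(K))` for every global `c` Kummer at all finite places) and the vanishing of the point obstruction
  `∑_{v∈∞∪S} inv_v(t_v ∪ₑ loc_v κ_{p^k}(P))` for every `P ∈ E(K)` ⟹ there is `y ∈ A₀ = h₀⁻¹(Sel_{p^∞}(E/K_∞))` with `loc_v y = x_v` for
  every `v ∈ S`, i.e. `(x_v)_v = Ψ[y]` is a value of the embedding. Proof: the sibling's `exists_subgroupH1_top_of_pointObstruction`, then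
  the second half of the rank-`0` proof `InputsGreenbergKerG.natCard_kerG_zero_eq_prod` verbatim (restriction to `K_∞` is Selmer: at
  `v ∈ S` because `x_v` dies over `K_{∞,η}`, off `S` because unramified classes are Kummer over the cyclotomic tower, at `∞` by the
  choice `0`).
* §2 `sum_invWeilPairing_kummerMapTorsion_eq_zero_of_sub_localization_mem` — **RECIPROCITY FOR THE POINT OBSTRUCTION**: if the
  local classes `t_v` differ from the localisations of ONE global class `c ∈ H¹(K, E[p^k])` by elements of `𝓛_v` on `S'`, and `c` is
  Kummer at the finite places off `S'` and `S'` contains every infinite place, then `∑_{v∈S'} inv_v(t_v ∪ₑ loc_v κ_{p^k}(P)) = 0` for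
  every `P ∈ E(K)` (`SumLocalTermEqZero` via the tree's `sum_inv_weilCupProduct_localization_eq_zero`, plus isotropy of `𝓛_v`).
  This is the converse inclusion «image ⊆ point-orthogonal classes» read at the level of Kummer lifts.

What is NOT here (for the exact count `#(A₀/Sel₀)·[E(K) : E_𝒦] = ∏_{v∈S} #𝒦_{v,0}[p^∞]`, KERINDEX-L-ROAD §2): the level-`p^k` lift of a
class of `A₀` with the archimedean vanishing `loc_w y = 0` (so that §2 applies to `Ψ[y]`), and the finite bilinear count.

References: [GreenbergLNM1716] §3 pp. 85–90, §4 p. 104, Lemma 4.7 (pp. 107–108), Appendix Prop. 4.13 (pp. 120–123);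
[GreenbergVatsal2000] §2 pp. 16–17; [MilneADT2006] I Thm. 4.10, Lemma 6.15; [Cassels1964ArithmeticVII].
bears_on: stmt-BirchSwinnertonDyer-23008 (helper; closes nothing), stmt-BirchSwinnertonDyer-22298 (attach seat's item; untouched).
-/

set_option autoImplicit false
-- the Theorems namespace of this sub repeats the summit name by design (D-0017 nested layout)
set_option linter.dupNamespace false

noncomputable section

open scoped Classical NumberField

open CategoryTheory Field NumberField IsDedekindDomain Function WeierstrassCurve
open Literature.NumberTheory.EllipticCurves Literature.NumberTheory.EllipticCurves.GreenbergSelmer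
open Literature.NumberTheory.GaloisRepresentations
open Literature.NumberTheory.GaloisRepresentations.DiscreteGaloisModule (SelmerStructure unramifiedSubgroup mu MuCarrier)
open Literature.NumberTheory.GaloisCohomology
open scoped ContRepresentation

namespace Summit.BirchSwinnertonDyer.BirchSwinnertonDyer.Theorems.AlignedTransportAtTwoEulerCharAtTwoKerGImage

open Summit.BirchSwinnertonDyer.Rank1Residual.X11b Summit.BirchSwinnertonDyer.Rank1Residual.X11b.KummerPT
open Summit.BirchSwinnertonDyer.Rank1Residual.X11b.LocBridge
open Summit.BirchSwinnertonDyer.Rank1Residual.X11b.Levels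
open Summit.BirchSwinnertonDyer.Rank1Residual.X11b.AcSelmer
open Summit.BirchSwinnertonDyer.Rank1Residual.X11b.Relaxation
open Summit.BirchSwinnertonDyer.Rank1Residual.X11b.KummerDecomp
open Summit.BirchSwinnertonDyer.BirchSwinnertonDyer.Theorems.SignedEC.CasselsPT
open Summit.BirchSwinnertonDyer.BirchSwinnertonDyer.Theorems.AlignedTransportAtTwoEulerCharAtTwoKerGCassels
open ZpExtension Literature.NumberTheory.EllipticCurves.GreenbergVatsal2000 Summit.BirchSwinnertonDyer.Rank1Residual.X2

/-! ## §0 The layer-`0` subgroup is all of `Γ_K` -/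

section LayerZero

variable {K : Type} [Field K] {p : ℕ} [Fact p.Prime] (κ : ZpExtension K p) (E : Type) [Field E] [Algebra K E]

/-- `(Γ_E → Γ_K)⁻¹(⊤) ≤ (Γ_E → Γ_K)⁻¹(κ⁻¹(p⁰ ℤ_p))` (both are all of `Γ_E`: `layerSubgroup_zero`). [folklore] -/
theorem localSubgroup_top_le_layerSubgroup_zero :
    localSubgroup (⊤ : Subgroup (absoluteGaloisGroup K)) E ≤ localSubgroup (κ.layerSubgroup 0) E :=
  Subgroup.comap_mono (by rw [ZpExtension.layerSubgroup_zero])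

end LayerZero

/-! ## §1 Image ⊇ point-orthogonal classes -/

section Image

variable {K : Type} [Field K] [NumberField K] (W : WeierstrassCurve K) [W.IsElliptic] (p : ℕ) [hp : Fact p.Prime]
  (κ : ZpExtension K p) (k : ℕ)
  (ew : W.geomTorsion ((p ^ k : ℕ) : ℤ) → W.geomTorsion ((p ^ k : ℕ) : ℤ) → AlgebraicClosure K)
  (hμ : ∀ S T, ew S T ^ (p ^ k) = 1)
  (hadd₁ : ∀ S₁ S₂ T, ew (S₁ + S₂) T = ew S₁ T * ew S₂ T)
  (hadd₂ : ∀ S T₁ T₂, ew S (T₁ + T₂) = ew S T₁ * ew S T₂)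
  (hgal : ∀ (σ : absoluteGaloisGroup K) (S T : W.geomTorsion ((p ^ k : ℕ) : ℤ)), σ • ew S T = ew (σ • S) (σ • T))
  (halt : ∀ T, ew T T = 1) (hnondeg : ∀ T, (∀ S, ew S T = 1) → T = 0)

include halt hnondeg in
/-- **IMAGE OF `A₀/Sel₀ ↪ ∏_{v∈S} 𝒦_{v,0}[p^∞]` ⊇ THE POINT-ORTHOGONAL CLASSES (Greenberg L.4.7 / Cassels–Poitou–Tate in positive
rank).** `K` a number field, `κ` the CYCLOTOMIC `ℤ_p`-extension, `E(K̄)[p^∞]^{Γ_K} = 0`, `S` finite with good reduction and `v ∤ p`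
off `S`; local classes `x_v ∈ 𝒦_{v,0}[p^∞]` (`v ∈ S`) killed by `p^n`; level `p^k`, `k = n + 1 + e`, Poitou–Tate family `inv`, Weil
pairing `ew`; Kummer lifts `t` of the `x_v` on `S` and of `0` at every infinite place; the Ш-exponent hypothesis; and
`∑_{v∈∞∪S} inv_v(t_v ∪ₑ loc_v κ_{p^k}(P)) = 0` for all `P ∈ E(K)`. THEN some `y ∈ A₀ = h₀⁻¹(Sel_{p^∞}(E/K_∞))` has `loc_v y = x_v`
for every `v ∈ S` — so `(x_v)_v` is the value `Ψ[y]` of the embedding `…KerGEmbedding.exists_kerG_zero_embedding`. With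
`Sel_{p^∞}(E/K)` finite this is the surjectivity half of `InputsGreenbergKerG.natCard_kerG_zero_eq_prod`.
[cite: GreenbergLNM1716, §4 p. 104, Lemma 4.7 (pp. 107–108), Prop. 4.13 (p. 122); §3 p. 90] [cite: GreenbergVatsal2000, §2 pp. 16–17] -/
theorem exists_mem_selmerInftyPreimage_of_pointObstruction (hκ : κ.IsCyclotomic)
    (hE0 : Nat.card (MulAction.fixedPoints (absoluteGaloisGroup K) (W.geomPrimaryTorsion p)) = 1)
    (S : Finset (HeightOneSpectrum (𝓞 K)))
    (hS : ∀ v ∉ S, ((p : ℕ) : 𝓞 K) ∉ v.asIdeal ∧ W.HasGoodReductionAt v)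
    (x : ∀ v : S, W.localTowerKerPrimary κ (v.1.adicCompletion K) 0)
    {n e : ℕ} (hk : n + 1 + e = k) (hxn : ∀ v : S, p ^ n • x v = 0)
    {inv : LocalInvariants K (p ^ k)} (hperf : inv.IsPerfect) (hcompl : inv.SelmerComplement)
    (hSha : ∀ c : galoisCohomology (W.torsionGaloisModule ((p ^ k : ℕ) : ℤ)) 1,
      (∀ v : HeightOneSpectrum (𝓞 K),
        galoisCohomology.localization (W.torsionGaloisModule ((p ^ k : ℕ) : ℤ)) (Sum.inr v) 1 c ∈
          W.kummerSelmerStructure ((p ^ k : ℕ) : ℤ) (Sum.inr v)) →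
      p ^ e • c ∈ (kummerMapTorsion W ((p ^ k : ℕ) : ℤ)
        (W.zsmul_geomPoints_surjective_holds (natCast_pow_ne_zero p k))).range)
    (t : Π v : Place K, galoisCohomology ((W.torsionGaloisModule ((p ^ k : ℕ) : ℤ)).toLocal v) 1)
    (htS : ∀ v : S,
      resH1Hom (Literature.NumberTheory.EllipticCurves.subgroupIncl
          (localSubgroup (⊤ : Subgroup (absoluteGaloisGroup K)) (v.1.adicCompletion K)))
        (AddMonoidHom.id (localPoints W (v.1.adicCompletion K))) (fun _ _ ↦ rfl)
        (galoisCohomology.map (W.torsionPointsMapIntertwining ((p ^ k : ℕ) : ℤ) (v.1.adicCompletion K)) 1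
          (t (Sum.inr v.1))) =
      Literature.NumberTheory.EllipticCurves.resOfLe (localPoints W (v.1.adicCompletion K))
        (localSubgroup_top_le_layerSubgroup_zero κ (v.1.adicCompletion K))
        ((x v : W.localTowerKerPrimary κ (v.1.adicCompletion K) 0) :
          discreteH1 (localSubgroup (κ.layerSubgroup 0) (v.1.adicCompletion K)) (localPoints W (v.1.adicCompletion K))))
    (hti : ∀ w : InfinitePlace K,
      resH1Hom (Literature.NumberTheory.EllipticCurves.subgroupIncl
          (localSubgroup (⊤ : Subgroup (absoluteGaloisGroup K)) w.Completion))
        (AddMonoidHom.id (localPoints W w.Completion)) (fun _ _ ↦ rfl)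
        (galoisCohomology.map (W.torsionPointsMapIntertwining ((p ^ k : ℕ) : ℤ) w.Completion) 1
          (t (Sum.inl w))) = 0)
    (hobs : ∀ P : W.toAffine.Point,
      ∑ v ∈ (Finset.univ.image Sum.inl ∪ S.image Sum.inr : Finset (Place K)),
        invWeilPairing W (p ^ k) ew hμ hadd₁ hadd₂ hgal inv v (t v)
          (galoisCohomology.localization (W.torsionGaloisModule ((p ^ k : ℕ) : ℤ)) v 1
            (kummerMapTorsion W ((p ^ k : ℕ) : ℤ)
              (W.zsmul_geomPoints_surjective_holds (natCast_pow_ne_zero p k)) P)) = 0) :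
    ∃ y ∈ W.selmerInftyPreimage κ 0, ∀ v : S,
      W.localResOver p (κ.layerSubgroup 0) (v.1.adicCompletion K) y =
        ((x v : W.localTowerKerPrimary κ (v.1.adicCompletion K) 0) :
          discreteH1 (localSubgroup (κ.layerSubgroup 0) (v.1.adicCompletion K)) (localPoints W (v.1.adicCompletion K))) := by
  -- notation
  let A : AddSubgroup (W.subgroupH1 p (κ.layerSubgroup 0)) := W.selmerInftyPreimage κ 0
  let T : HeightOneSpectrum (𝓞 K) → Type := fun v ↦ W.localTowerKerPrimary κ (v.adicCompletion K) 0
  -- transports between the layer-`0` groups and the groups at `⊤`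
  have hge : ∀ (E : Type) [Field E] [Algebra K E],
      localSubgroup (⊤ : Subgroup (absoluteGaloisGroup K)) E ≤ localSubgroup (κ.layerSubgroup 0) E :=
    fun E _ _ ↦ localSubgroup_top_le_layerSubgroup_zero κ E
  have hleL : ∀ (E : Type) [Field E] [Algebra K E],
      localSubgroup (κ.layerSubgroup 0) E ≤ localSubgroup (⊤ : Subgroup (absoluteGaloisGroup K)) E :=
    fun E _ _ ↦ Subgroup.comap_mono le_top
  -- the local classes to prescribe at `⊤`
  let xS : ∀ v : HeightOneSpectrum (𝓞 K),
      discreteH1 (localSubgroup (⊤ : Subgroup (absoluteGaloisGroup K)) (v.adicCompletion K))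
        (localPoints W (v.adicCompletion K)) := fun v ↦
    if h : v ∈ S then Literature.NumberTheory.EllipticCurves.resOfLe (localPoints W (v.adicCompletion K))
      (hge (v.adicCompletion K)) ((x ⟨v, h⟩ : T v) : _) else 0
  have hxS : ∀ v (h : v ∈ S), xS v = Literature.NumberTheory.EllipticCurves.resOfLe (localPoints W (v.adicCompletion K))
      (hge (v.adicCompletion K)) ((x ⟨v, h⟩ : T v) : _) := fun v h ↦ dif_pos h
  have hxSn : ∀ v ∈ S, p ^ n • xS v = 0 := fun v h ↦ by
    rw [hxS v h, ← map_nsmul]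
    have h0 : ((p ^ n • x ⟨v, h⟩ : T v) : discreteH1 (localSubgroup (κ.layerSubgroup 0) (v.adicCompletion K))
        (localPoints W (v.adicCompletion K))) = 0 := by rw [hxn ⟨v, h⟩]; rfl
    rw [AddSubgroup.coe_nsmul] at h0
    rw [h0, map_zero]
  let xi : ∀ w : InfinitePlace K,
      discreteH1 (localSubgroup (⊤ : Subgroup (absoluteGaloisGroup K)) w.Completion) (localPoints W w.Completion) :=
    fun _ ↦ 0
  have htS' : ∀ v ∈ S,
      resH1Hom (Literature.NumberTheory.EllipticCurves.subgroupIncl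
          (localSubgroup (⊤ : Subgroup (absoluteGaloisGroup K)) (v.adicCompletion K)))
        (AddMonoidHom.id (localPoints W (v.adicCompletion K))) (fun _ _ ↦ rfl)
        (galoisCohomology.map (W.torsionPointsMapIntertwining ((p ^ k : ℕ) : ℤ) (v.adicCompletion K)) 1
          (t (Sum.inr v))) = xS v := fun v h ↦ by
    rw [hxS v h]; exact htS ⟨v, h⟩
  -- the positive-rank Cassels theorem
  obtain ⟨y, hyH, hyfin, hyinf⟩ := exists_subgroupH1_top_of_pointObstruction W p k ew hμ hadd₁ hadd₂ hgal halt hnondeg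
    hE0 S hS xS xi hk hxSn (fun _ ↦ smul_zero _) hperf hcompl hSha t htS' hti hobs
  -- `y₀ = res y ∈ H¹(K_0, E[p^∞])` and its image in `H¹(K_∞, E[p^∞])`
  let y₀ : W.subgroupH1 p (κ.layerSubgroup 0) := W.resOfLe p (le_top : κ.layerSubgroup 0 ≤ ⊤) y
  have hh : W.layerToInfty κ 0 y₀ = W.resOfLe p (le_top : κ.kerSubgroup ≤ ⊤) y := by
    change (W.resOfLe p (κ.kerSubgroup_le_layerSubgroup 0)) (W.resOfLe p (le_top : κ.layerSubgroup 0 ≤ ⊤) y) = _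
    rw [← AddMonoidHom.comp_apply, W.resOfLe_comp_holds p]
  -- the local restrictions of `res y` over `K_∞` vanish at `v ∈ S` and at `∞`
  have hlocS : ∀ v ∈ S, W.resOfLe p (le_top : κ.kerSubgroup ≤ ⊤) y ∈ W.localKerOver p κ.kerSubgroup (v.adicCompletion K) := by
    intro v hv
    rw [mem_localKerOver_iff]
    change W.localResOverOfEmb p κ.kerSubgroup (closureEmb (K := K) (v.adicCompletion K)) _ = 0
    rw [W.localResOverOfEmb_resOfLe p (closureEmb (K := K) (v.adicCompletion K)) (le_top : κ.kerSubgroup ≤ ⊤) y]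
    change Literature.NumberTheory.EllipticCurves.resOfLe _ _ (W.localResOver p ⊤ (v.adicCompletion K) y) = 0
    rw [hyfin v hv, hxS v hv, ← AddMonoidHom.comp_apply, Literature.NumberTheory.EllipticCurves.resOfLe_comp_holds]
    exact ((W.mem_localTowerKerPrimary_iff κ _ 0 _).mp (x ⟨v, hv⟩).2).1
  have hlocinf : ∀ w : InfinitePlace K,
      W.resOfLe p (le_top : κ.kerSubgroup ≤ ⊤) y ∈ W.localKerOver p κ.kerSubgroup w.Completion := by
    intro w
    rw [mem_localKerOver_iff]
    change W.localResOverOfEmb p κ.kerSubgroup (closureEmb (K := K) w.Completion) _ = 0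
    rw [W.localResOverOfEmb_resOfLe p (closureEmb (K := K) w.Completion) (le_top : κ.kerSubgroup ≤ ⊤) y]
    change Literature.NumberTheory.EllipticCurves.resOfLe _ _ (W.localResOver p ⊤ w.Completion y) = 0
    rw [hyinf w, map_zero]
  -- hence `res y ∈ Sel_{p^∞}(E/K_∞)`, i.e. `y₀ ∈ A₀`
  have hy₀ : y₀ ∈ A := by
    rw [W.mem_selmerInftyPreimage_iff κ 0, hh]
    change W.resOfLe p (le_top : κ.kerSubgroup ≤ ⊤) y ∈ W.selmerGroupOver p κ.kerSubgroup
    have hyH' : W.resOfLe p (le_top : κ.kerSubgroup ≤ ⊤) y ∈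
        unramifiedOutside κ.kerSubgroup (W.geomPrimaryTorsion p) p (↑S : Set (HeightOneSpectrum (𝓞 K))) :=
      SSFlatEC.resOfLe_mem_unramifiedOutside (W.geomPrimaryTorsion p) (le_top : κ.kerSubgroup ≤ ⊤) p _ hyH
    have honeK : ∀ {B : AddSubgroup (W.subgroupH1 p κ.kerSubgroup)} {z : W.subgroupH1 p κ.kerSubgroup},
        W.conjH1 p κ.kerSubgroup 1 z ∈ B → z ∈ B := fun {B z} h ↦ by
      rwa [W.conjH1_one_holds p κ.kerSubgroup, AddMonoidHom.id_apply] at h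
    refine (W.mem_selmerGroupOver_iff p κ.kerSubgroup _).mpr ⟨fun v σ ↦ ?_, fun w σ ↦ ?_⟩
    · rw [SSFlatEC.conjH1_resOfLe_top W κ σ y]
      by_cases hv : v ∈ S
      · exact hlocS v hv
      · exact GreenbergVatsalUnramifiedAway.unramKer_le_localKerOver_of_isCyclotomic (κ := κ) (v := v) (W := W)
          (p := p) hκ (hS v hv).2 (hS v hv).1
          (honeK ((mem_unramifiedOutside_iff _).mp hyH' v (fun h ↦ hv (Finset.mem_coe.mp h)) (hS v hv).1 1))
    · rw [SSFlatEC.conjH1_resOfLe_top W κ σ y]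
      exact hlocinf w
  -- and `loc_v y₀ = x_v` on `S`
  refine ⟨y₀, hy₀, fun v ↦ ?_⟩
  change W.localResOverOfEmb p (κ.layerSubgroup 0) (closureEmb (K := K) (v.1.adicCompletion K)) y₀ = _
  rw [W.localResOverOfEmb_resOfLe p (closureEmb (K := K) (v.1.adicCompletion K)) (le_top : κ.layerSubgroup 0 ≤ ⊤) y]
  change Literature.NumberTheory.EllipticCurves.resOfLe _ _ (W.localResOver p ⊤ (v.1.adicCompletion K) y) = _
  rw [hyfin v.1 v.2, hxS v.1 v.2]
  have e1 := congrArg (fun f ↦ f ((x v : T v) : _))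
    (Literature.NumberTheory.EllipticCurves.resOfLe_comp_holds (M := localPoints W (v.1.adicCompletion K))
      (hleL (v.1.adicCompletion K)) (hge (v.1.adicCompletion K)))
  have e2 := congrArg (fun f ↦ f ((x v : T v) : _))
    (Literature.NumberTheory.EllipticCurves.resOfLe_refl_holds (M := localPoints W (v.1.adicCompletion K))
      (localSubgroup (κ.layerSubgroup 0) (v.1.adicCompletion K)))
  exact e1.trans e2

end Image


/-! ## §2 Reciprocity: the point obstruction of the Kummer lifts of a GLOBAL class vanishes -/

section Reciprocity

variable {K : Type} [Field K] [NumberField K] (W : WeierstrassCurve K) [W.IsElliptic] (p : ℕ) [hp : Fact p.Prime]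
  (k : ℕ)
  (ew : W.geomTorsion ((p ^ k : ℕ) : ℤ) → W.geomTorsion ((p ^ k : ℕ) : ℤ) → AlgebraicClosure K)
  (hμ : ∀ S T, ew S T ^ (p ^ k) = 1)
  (hadd₁ : ∀ S₁ S₂ T, ew (S₁ + S₂) T = ew S₁ T * ew S₂ T)
  (hadd₂ : ∀ S T₁ T₂, ew S (T₁ + T₂) = ew S T₁ * ew S T₂)
  (hgal : ∀ (σ : absoluteGaloisGroup K) (S T : W.geomTorsion ((p ^ k : ℕ) : ℤ)), σ • ew S T = ew (σ • S) (σ • T))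
  (halt : ∀ T, ew T T = 1)

include halt in
/-- **RECIPROCITY FOR THE POINT OBSTRUCTION.** At level `p^k`, for a Poitou–Tate family `inv` with `SumLocalTermEqZero`
and a Weil pairing `ew`: if `c ∈ H¹(K, E[p^k])` is a GLOBAL class satisfying the Kummer condition outside the finite set `S'`
(`c ∈ kummerOutside W (p^k) S'`) and the local classes `t_v` satisfy `t_v − loc_v c ∈ 𝓛_v` for `v ∈ S'`, then
`∑_{v∈S'} inv_v(t_v ∪ₑ loc_v κ_{p^k}(P)) = 0` for every `P ∈ E(K)`: replace `t_v` by `loc_v c` (isotropy of `𝓛_v`, which contains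
`t_v − loc_v c` and `loc_v κ(P)`), then Poitou–Tate `∑_v inv_v(loc_v c ∪ₑ loc_v κ(P)) = 0`, the terms off `S'` vanishing by isotropy
again. This is the inclusion «classes that ARE global are point-orthogonal» (Greenberg p. 104: the image of
`H¹(K_Σ/K, E[p^∞]) → 𝒫_E^Σ(K)` is orthogonal to the compact Selmer group). [cite: GreenbergLNM1716, §4 p. 104 and Prop. 4.13 (p. 121)]
[cite: MilneADT2006, Ch. I, Thm. 4.10(b)] [cite: PoonenRains2012, Prop. 4.8] -/
theorem sum_invWeilPairing_kummerMapTorsion_eq_zero_of_sub_localization_mem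
    {inv : LocalInvariants K (p ^ k)} (hvan : inv.SumLocalTermEqZero)
    (S' : Finset (Place K)) {c : galoisCohomology (W.torsionGaloisModule ((p ^ k : ℕ) : ℤ)) 1}
    (hc : c ∈ kummerOutside W (p ^ k) S')
    (t : Π v : Place K, galoisCohomology ((W.torsionGaloisModule ((p ^ k : ℕ) : ℤ)).toLocal v) 1)
    (ht : ∀ v ∈ S', t v - galoisCohomology.localization (W.torsionGaloisModule ((p ^ k : ℕ) : ℤ)) v 1 c ∈
      W.kummerSelmerStructure ((p ^ k : ℕ) : ℤ) v)
    (P : W.toAffine.Point) :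
    ∑ v ∈ S', invWeilPairing W (p ^ k) ew hμ hadd₁ hadd₂ hgal inv v (t v)
        (galoisCohomology.localization (W.torsionGaloisModule ((p ^ k : ℕ) : ℤ)) v 1
          (kummerMapTorsion W ((p ^ k : ℕ) : ℤ)
            (W.zsmul_geomPoints_surjective_holds (natCast_pow_ne_zero p k)) P)) = 0 := by
  have hprime : p.Prime := Fact.out
  haveI : NeZero (p ^ k) := ⟨pow_ne_zero k hprime.ne_zero⟩
  set κP : galoisCohomology (W.torsionGaloisModule ((p ^ k : ℕ) : ℤ)) 1 :=
    kummerMapTorsion W ((p ^ k : ℕ) : ℤ) (W.zsmul_geomPoints_surjective_holds (natCast_pow_ne_zero p k)) P with hκPdef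
  set loc : ∀ v : Place K, galoisCohomology (W.torsionGaloisModule ((p ^ k : ℕ) : ℤ)) 1 →+
      galoisCohomology ((W.torsionGaloisModule ((p ^ k : ℕ) : ℤ)).toLocal v) 1 :=
    fun v ↦ galoisCohomology.localization (W.torsionGaloisModule ((p ^ k : ℕ) : ℤ)) v 1 with hlocdef
  -- `loc_v κ P ∈ 𝓛_v` everywhere
  have hκL : ∀ v : Place K, loc v κP ∈ W.kummerSelmerStructure ((p ^ k : ℕ) : ℤ) v := fun v ↦
    localization_kummerMapTorsion_mem W (p ^ k) v P
  -- replace `t_v` by `loc_v c`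
  have hrepl : ∀ v ∈ S', invWeilPairing W (p ^ k) ew hμ hadd₁ hadd₂ hgal inv v (t v) (loc v κP) =
      invWeilPairing W (p ^ k) ew hμ hadd₁ hadd₂ hgal inv v (loc v c) (loc v κP) := fun v hv ↦ by
    rw [← sub_eq_zero, ← AddMonoidHom.sub_apply, ← map_sub]
    exact invWeilPairing_eq_zero_of_mem W (p ^ k) ew hμ hadd₁ hadd₂ hgal halt inv v (ht v hv) (hκL v)
  rw [Finset.sum_congr rfl hrepl]
  -- Poitou–Tate for the global pair `(c, κ P)`; the terms off `S'` vanish by isotropy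
  have h := sum_inv_weilCupProduct_localization_eq_zero W (p ^ k) ew hμ hadd₁ hadd₂ hgal inv hvan c κP S'
    (fun v hv ↦ by
      have h' := invWeilPairing_eq_zero_of_mem W (p ^ k) ew hμ hadd₁ hadd₂ hgal halt inv v
        ((mem_kummerOutside_iff W (p ^ k) S' c).mp hc v hv) (hκL v)
      rwa [invWeilPairing_apply] at h')
  simpa only [invWeilPairing_apply] using h

end Reciprocity

end Summit.BirchSwinnertonDyer.BirchSwinnertonDyer.Theorems.AlignedTransportAtTwoEulerCharAtTwoKerGImage

end
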